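import Mathlib.Algebra.CharP.Lemmas
import Mathlib.Algebra.Ring.GeomSum
import Mathlib.Data.ZMod.Basic
import Mathlib.Algebra.Polynomial.Monic
import Mathlib.Algebra.Polynomial.AlgebraMap
import Mathlib.RingTheory.Polynomial.Basic
import Mathlib.Tactic.LinearCombination
import Mathlib.Tactic.Ring

/-!
# SoloBlind — the algebraic skeleton of the linearisation of `J₄` on its third blow-up (Theorem V₄)

Solo line `solo-ResolutionOfSingularities-blind`, session 6.  Let `σ = J₄` act on `K[x₁,x₂,x₃,x₄]`
(`char K = p ≥ 5`) by `x₁ ↦ x₁+x₂, x₂ ↦ x₂+x₃, x₃ ↦ x₃+x₄, x₄ ↦ x₄`.  Theorem V₄ of the accompanying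
paper (§12.2) resolves the wild, non-Cohen–Macaulay quotient `𝔸⁴/⟨J₄⟩`: after three equivariant blow-ups
`Y₃ → 𝔸⁴` the automorphism is, at every point of the three curves `Γ₀, Γ_{1/2}, Γ_∞` of zeros of its
residual vector field, formally conjugate to a diagonal `𝔾_m`-action evaluated at `T = 1 + W`, where
`W = 1/Θ` for an Artin–Schreier generator `Θ` (`σΘ = Θ + 1`) and the coordinates are SEMI-INVARIANTS
`Θ^e · I` (`I` invariant, `e ∈ ℤ` the weight).  Everything in that proof that is pure commutative algebra is
kernel-checked here, over an arbitrary commutative ring (no fraction field, no power series):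

* the invariants used: `F₂ = x₃² - 2x₂x₄ - x₃x₄`, `3P₃ = 3x₁x₄² - 3x₂x₃x₄ + x₃³ - x₃x₄²`
  (`SoloBlind.V4_F2_invariant`, `SoloBlind.V4_P3_invariant`) and, in characteristic `p`,
  `N₃ = x₃^p - x₃x₄^{p-1}` (`SoloBlind.V4_N3_invariant`);
* the numerator of the Artin–Schreier generator used at `Γ₀`,
  `Θ'' = x₃/x₄ - N₃/(x₄F₂^h)` (`p = 2h+1`), is divisible by `x₄`:
  `x₄ ∣ x₃·F₂^h - N₃` (`SoloBlind.V4_Theta_numerator_dvd`) — this is what makes `Θ''` regular off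
  `{F₂ = 0} ∪ E₃` and `1/Θ'' = (unit)·u` along `Γ₀`;
* the discrete Taylor primitive: with `σT = T+1`,
  `ψ = T x₂ - binom(T+1,2) x₃ + binom(T+2,3) x₄` satisfies `σψ - ψ = x₂`, written denominator-free
  (`SoloBlind.V4_discreteTaylor_primitive`); hence `ξ = x₁ - ψ` is invariant and `Y₃/σ ≅ (Y₃'/σ') × 𝔸¹`
  locally (§12.2, step (c));
* the chart factorisations on chart A of `Y₃` (`x₂ = yu, x₃ = yu², x₄ = vyu³`, `E₃ = {u = 0}`):
  `F₂ = y²u⁴(1 - 2v - uv)` and `3P₃ = y²u⁶(3x₁v² + y(1 - 3v) - yu²v²)`, and on chart B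
  (`x₂ = y u₃ v₁, x₃ = y u₃² v₁², x₄ = y u₃² v₁³`, `E₃ = {v₁ = 0}`): `F₂ = y²u₃³v₁⁴(u₃ - 2 - u₃v₁)`
  (`SoloBlind.V4_F2_chartA`, `SoloBlind.V4_P3_chartA`, `SoloBlind.V4_F2_chartB`) — these exhibit the
  semi-invariant coordinates as (monomial)·(unit) near the three curves;
* the trace identity behind §12.1: in characteristic `p`, `(X - 1)^{p-1} = Σ_{j<p} X^j` as polynomials, hence
  `(s - 1)^{p-1} = Σ_{j<p} s^j` for every element `s` of a commutative `𝔽_p`-algebra — applied to `s = σ`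
  in the (commutative) algebra `𝔽_p[σ]` this is `Tr = Σ σ^j = (σ - 1)^{p-1}`
  (`SoloBlind.sub_one_pow_pred_eq_geom_sum_X`, `SoloBlind.sub_one_pow_pred_eq_geom_sum`).
-/

namespace Summit.ResolutionOfSingularities.ResolutionOfSingularities.Theorems

open Finset Polynomial

section Invariants

variable {R : Type*} [CommRing R]

/-- The quadratic invariant `F₂ = x₃² - 2x₂x₄ - x₃x₄` of `J₄` (indeed of `J₃` on `x₂,x₃,x₄`). -/
def SoloBlind.V4F2 (x₂ x₃ x₄ : R) : R := x₃ ^ 2 - 2 * x₂ * x₄ - x₃ * x₄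

/-- Three times the cubic invariant: `3P₃ = 3x₁x₄² - 3x₂x₃x₄ + x₃³ - x₃x₄²` (`= 3x₄³·I₁`). -/
def SoloBlind.V4P3 (x₁ x₂ x₃ x₄ : R) : R :=
  3 * x₁ * x₄ ^ 2 - 3 * x₂ * x₃ * x₄ + x₃ ^ 3 - x₃ * x₄ ^ 2

/-- The norm of `x₃`: `N₃ = x₃^p - x₃ x₄^{p-1}`, written with `p = q + 1`. -/
def SoloBlind.V4N3 (q : ℕ) (x₃ x₄ : R) : R := x₃ ^ (q + 1) - x₃ * x₄ ^ q

/-- `F₂` is invariant under `J₄`: `x₂ ↦ x₂+x₃, x₃ ↦ x₃+x₄, x₄ ↦ x₄` (any commutative ring). -/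
theorem SoloBlind.V4_F2_invariant (x₂ x₃ x₄ : R) :
    SoloBlind.V4F2 (x₂ + x₃) (x₃ + x₄) x₄ = SoloBlind.V4F2 x₂ x₃ x₄ := by
  unfold SoloBlind.V4F2; ring

/-- `3P₃` is invariant under `J₄`: `x₁ ↦ x₁+x₂, x₂ ↦ x₂+x₃, x₃ ↦ x₃+x₄, x₄ ↦ x₄` (any commutative ring). -/
theorem SoloBlind.V4_P3_invariant (x₁ x₂ x₃ x₄ : R) :
    SoloBlind.V4P3 (x₁ + x₂) (x₂ + x₃) (x₃ + x₄) x₄ = SoloBlind.V4P3 x₁ x₂ x₃ x₄ := by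
  unfold SoloBlind.V4P3; ring

/-- `N₃` is `J₄`-invariant in characteristic `p` (`p = q+1`): uses only `(a+b)^p = a^p + b^p`. -/
theorem SoloBlind.V4_N3_invariant (p : ℕ) [hp : Fact p.Prime] [CharP R p] (q : ℕ) (hq : p = q + 1)
    (x₃ x₄ : R) :
    SoloBlind.V4N3 q (x₃ + x₄) x₄ = SoloBlind.V4N3 q x₃ x₄ := by
  unfold SoloBlind.V4N3
  have H : (x₃ + x₄) ^ p = x₃ ^ p + x₄ ^ p := add_pow_char x₃ x₄ p
  rw [hq] at H
  rw [H]
  ring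

/-- The numerator of the Artin–Schreier generator `Θ'' = (x₃F₂^h - N₃)/(x₄F₂^h)` (`p = 2h+1`,
`h ≥ 1`, here written with `h+1` in place of `h`) is divisible by `x₄`; valid over any commutative ring. -/
theorem SoloBlind.V4_Theta_numerator_dvd (h : ℕ) (x₂ x₃ x₄ : R) :
    x₄ ∣ x₃ * SoloBlind.V4F2 x₂ x₃ x₄ ^ (h + 1) - SoloBlind.V4N3 (2 * h + 2) x₃ x₄ := by
  unfold SoloBlind.V4F2 SoloBlind.V4N3
  have h1 : x₃ ^ 2 - 2 * x₂ * x₄ - x₃ * x₄ - x₃ ^ 2 ∣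
      (x₃ ^ 2 - 2 * x₂ * x₄ - x₃ * x₄) ^ (h + 1) - (x₃ ^ 2) ^ (h + 1) := sub_dvd_pow_sub_pow _ _ (h + 1)
  have h2 : x₄ ∣ x₃ ^ 2 - 2 * x₂ * x₄ - x₃ * x₄ - x₃ ^ 2 :=
    ⟨-(2 * x₂ + x₃), by ring⟩
  have h3 : x₄ ∣ x₃ * ((x₃ ^ 2 - 2 * x₂ * x₄ - x₃ * x₄) ^ (h + 1) - (x₃ ^ 2) ^ (h + 1)) :=
    dvd_mul_of_dvd_right (dvd_trans h2 h1) _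
  have h4 : x₄ ∣ x₃ * x₄ ^ (2 * h + 2) := ⟨x₃ * x₄ ^ (2 * h + 1), by ring⟩
  have key : x₃ * (x₃ ^ 2 - 2 * x₂ * x₄ - x₃ * x₄) ^ (h + 1)
        - (x₃ ^ (2 * h + 2 + 1) - x₃ * x₄ ^ (2 * h + 2))
      = x₃ * ((x₃ ^ 2 - 2 * x₂ * x₄ - x₃ * x₄) ^ (h + 1) - (x₃ ^ 2) ^ (h + 1))
        + x₃ * x₄ ^ (2 * h + 2) := by
    ring
  rw [key]
  exact dvd_add h3 h4

/-- Discrete Taylor primitive (denominator-free): with `6ψ = 6T x₂ - 3T(T+1) x₃ + T(T+1)(T+2) x₄` and the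
substitution `σ : T ↦ T+1, x₂ ↦ x₂+x₃, x₃ ↦ x₃+x₄, x₄ ↦ x₄` one has `σ(6ψ) - 6ψ = 6x₂`. -/
theorem SoloBlind.V4_discreteTaylor_primitive (T x₂ x₃ x₄ : R) :
    (6 * (T + 1) * (x₂ + x₃) - 3 * (T + 1) * (T + 2) * (x₃ + x₄) + (T + 1) * (T + 2) * (T + 3) * x₄)
      - (6 * T * x₂ - 3 * T * (T + 1) * x₃ + T * (T + 1) * (T + 2) * x₄) = 6 * x₂ := by
  ring

/-- Chart A of `Y₃` (`x₂ = yu, x₃ = yu², x₄ = vyu³`): `F₂ = y²u⁴(1 - 2v - uv)`. -/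
theorem SoloBlind.V4_F2_chartA (y u v : R) :
    SoloBlind.V4F2 (y * u) (y * u ^ 2) (v * y * u ^ 3) = y ^ 2 * u ^ 4 * (1 - 2 * v - u * v) := by
  unfold SoloBlind.V4F2; ring

/-- Chart A: `3P₃ = y²u⁶(3x₁v² + y(1 - 3v) - yu²v²)`; so `x₄·I₁ = P₃/x₄² = x₁ - y/v + y/(3v²) - yu²/3`
is regular where `v ≠ 0` (along `Γ_{1/2}`). -/
theorem SoloBlind.V4_P3_chartA (x₁ y u v : R) :
    SoloBlind.V4P3 x₁ (y * u) (y * u ^ 2) (v * y * u ^ 3)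
      = y ^ 2 * u ^ 6 * (3 * x₁ * v ^ 2 + y * (1 - 3 * v) - y * u ^ 2 * v ^ 2) := by
  unfold SoloBlind.V4P3; ring

/-- Chart B of `Y₃` (`x₂ = y u₃ v₁, x₃ = y u₃² v₁², x₄ = y u₃² v₁³`): `F₂ = y²u₃³v₁⁴(u₃ - 2 - u₃v₁)`. -/
theorem SoloBlind.V4_F2_chartB (y u₃ v₁ : R) :
    SoloBlind.V4F2 (y * u₃ * v₁) (y * u₃ ^ 2 * v₁ ^ 2) (y * u₃ ^ 2 * v₁ ^ 3)
      = y ^ 2 * u₃ ^ 3 * v₁ ^ 4 * (u₃ - 2 - u₃ * v₁) := by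
  unfold SoloBlind.V4F2; ring

/-- Chart B: `3P₃ = y² u₃⁴ v₁⁶ (3x₁ - 3yu₃ + yu₃² - yu₃²v₁²)`, so `x₄ I₁ = x₁ - yu₃ + yu₃²(1 - v₁²)/3`. -/
theorem SoloBlind.V4_P3_chartB (x₁ y u₃ v₁ : R) :
    SoloBlind.V4P3 x₁ (y * u₃ * v₁) (y * u₃ ^ 2 * v₁ ^ 2) (y * u₃ ^ 2 * v₁ ^ 3)
      = y ^ 2 * u₃ ^ 4 * v₁ ^ 6 * (3 * x₁ - 3 * y * u₃ + y * u₃ ^ 2 - y * u₃ ^ 2 * v₁ ^ 2) := by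
  unfold SoloBlind.V4P3; ring

end Invariants

section Trace

/-- In `𝔽_p[X]` (indeed over any commutative ring of characteristic `p`): `(X - 1)^{p-1} = Σ_{j<p} X^j`. -/
theorem SoloBlind.sub_one_pow_pred_eq_geom_sum_X (p : ℕ) [hp : Fact p.Prime] :
    ((X : Polynomial (ZMod p)) - 1) ^ (p - 1) = ∑ j ∈ range p, (X : Polynomial (ZMod p)) ^ j := by
  have hm : ((X : Polynomial (ZMod p)) - 1).Monic := by
    simpa using monic_X_sub_C (1 : ZMod p)
  apply hm.isRegular.right
  dsimp only
  rw [geom_sum_mul, ← pow_succ, Nat.sub_add_cancel hp.out.one_lt.le]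
  have H : ((X : Polynomial (ZMod p)) - 1) ^ p = X ^ p - 1 ^ p := sub_pow_char X 1
  rw [H, one_pow]

/-- For any element `s` of a commutative `ZMod p`-algebra: `(s - 1)^{p-1} = Σ_{j<p} s^j`.  With `s = σ` in the
commutative algebra generated by an automorphism of order `p`, this is `Σ_j σ^j = (σ - 1)^{p-1}`:
the trace is the top iterated difference (paper §12.1). -/
theorem SoloBlind.sub_one_pow_pred_eq_geom_sum (p : ℕ) [hp : Fact p.Prime] {A : Type*} [CommRing A]
    [Algebra (ZMod p) A] (s : A) :
    (s - 1) ^ (p - 1) = ∑ j ∈ range p, s ^ j := by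
  have H := congrArg (Polynomial.aeval s) (SoloBlind.sub_one_pow_pred_eq_geom_sum_X p)
  simpa [map_sub, map_pow, map_sum, aeval_X] using H

end Trace

end Summit.ResolutionOfSingularities.ResolutionOfSingularities.Theorems
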